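import Mathlib

/-!
# The remainder in polynomial interpolation, and interpolation at the Chebyshev nodes

**Remainder term** [cite: StoerBulirsch2002, Thm. 2.1.4.1] [cite: HammerlinHoffman1991, Ch. 5 §1.3]:
if `f ∈ C^{N}` and `p` is a polynomial of degree `< N` interpolating `f` at `N ≥ 1` distinct nodes
`x₁, …, x_N ⊆ [a, b]` (`a < b`), then for every `t ∈ [a, b]` there is `ξ ∈ (a, b)` with

  `f(t) - p(t) = f^{(N)}(ξ) / N! · (t - x₁) ⋯ (t - x_N)`,

hence the **remainder term bound** `|f(t) - p(t)| ≤ M / N! · |(t - x₁) ⋯ (t - x_N)|` whenever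
`|f^{(N)}| ≤ M` on `[a, b]` [cite: HammerlinHoffman1991, Ch. 5 §1.4].  (Stoer–Bulirsch place `ξ`
in the smallest interval containing the nodes and `t`; taking `[a, b]` to be that interval recovers
their form, with `ξ` in its interior.)

**Chebyshev nodes** [cite: HammerlinHoffman1991, Ch. 4 §4.7] [cite: HammerlinHoffman1991,
Ch. 5 §4.1]: the zeros `cos((2k+1)π/(2n))`, `k < n`, of the Chebyshev polynomial `T_n` satisfy
`∏_k (t - x_k) = T_n(t) / 2^{n-1}`, so `|∏_k (t - x_k)| ≤ 2^{1-n}` on `[-1, 1]`, and interpolation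
of `f ∈ C^{n}` at them has error `≤ M / (2^{n-1} n!)` on `[-1, 1]`.

The proof of the remainder term is the classical one (auxiliary function
`F = f - p - K ω`, `N + 1` zeros, repeated Rolle); the Chebyshev factorisation comes from Mathlib's
`Polynomial.Chebyshev.roots_T_real`, `leadingCoeff_T` and `abs_eval_T_real_le_one`.

## References

* J. Stoer, R. Bulirsch, *Introduction to Numerical Analysis*, 3rd ed., Springer (2002),
  Thm. 2.1.4.1. [cite: StoerBulirsch2002, Thm. 2.1.4.1]
* G. Hämmerlin, K.-H. Hoffmann, *Numerical Mathematics*, Springer (1991), Ch. 4 §4.7, Ch. 5 §1.3,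
  §1.4, §4.1. [cite: HammerlinHoffman1991, Ch. 5 §1.3]

AI-produced formalisation (H21 engines group, seat eng-cap-1, 2026-08-20); no facts, no axioms
beyond Mathlib's, no `sorry`.
-/

open Polynomial Set

open scoped Nat Real

namespace Literature.Analysis.Approximation

/-! ### Rolle's theorem on finite zero sets -/

/-- Rolle between consecutive zeros: if the continuous `g` vanishes on a nonempty finite set `s`,
then `deriv g` vanishes on a finite set `s'` with `#s' + 1 = #s`, each point of `s'` lying strictly
between two points of `s` and outside `s`. [folklore] -/
private theorem rolle_finset {g : ℝ → ℝ} (hg : Continuous g) (s : Finset ℝ) :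
    s.Nonempty → (∀ x ∈ s, g x = 0) →
      ∃ s' : Finset ℝ, s'.card + 1 = s.card ∧ (∀ x ∈ s', deriv g x = 0) ∧
        ∀ x ∈ s', x ∉ s ∧ (∃ a ∈ s, a < x) ∧ (∃ b ∈ s, x < b) := by
  classical
  induction s using Finset.induction_on_min with
  | empty => intro hne; exact absurd hne Finset.not_nonempty_empty
  | insert a t hlt ih =>
    intro _ hzero
    have hat : a ∉ t := fun h => lt_irrefl a (hlt a h)
    rcases t.eq_empty_or_nonempty with rfl | ht
    · exact ⟨∅, by simp, by simp, by simp⟩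
    set b := t.min' ht with hb
    have hbt : b ∈ t := Finset.min'_mem t ht
    have hab : a < b := hlt b hbt
    have hga : g a = 0 := hzero a (Finset.mem_insert_self a t)
    have hgb : g b = 0 := hzero b (Finset.mem_insert_of_mem hbt)
    obtain ⟨c, hc, hc0⟩ :=
      exists_deriv_eq_zero (f := g) hab hg.continuousOn (by rw [hga, hgb])
    obtain ⟨t', ht'card, ht'zero, ht'loc⟩ :=
      ih ht (fun x hx => hzero x (Finset.mem_insert_of_mem hx))
    have hct' : c ∉ t' := by
      intro h
      obtain ⟨-, ⟨a', ha't, ha'c⟩, -⟩ := ht'loc c h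
      have : b ≤ a' := Finset.min'_le t a' ha't
      linarith [hc.2]
    refine ⟨insert c t', ?_, ?_, ?_⟩
    · rw [Finset.card_insert_of_notMem hct', Finset.card_insert_of_notMem hat, ht'card]
    · intro x hx
      rcases Finset.mem_insert.mp hx with rfl | hx
      · exact hc0
      · exact ht'zero x hx
    · intro x hx
      rcases Finset.mem_insert.mp hx with rfl | hx
      · refine ⟨?_, ⟨a, Finset.mem_insert_self a t, hc.1⟩,
          ⟨b, Finset.mem_insert_of_mem hbt, hc.2⟩⟩
        intro hmem
        rcases Finset.mem_insert.mp hmem with h | h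
        · exact lt_irrefl a (h ▸ hc.1)
        · have : b ≤ x := Finset.min'_le t x h
          linarith [hc.2]
      · obtain ⟨hxt, ⟨a', ha't, ha'x⟩, ⟨b', hb't, hxb'⟩⟩ := ht'loc x hx
        refine ⟨?_, ⟨a', Finset.mem_insert_of_mem ha't, ha'x⟩,
          ⟨b', Finset.mem_insert_of_mem hb't, hxb'⟩⟩
        intro hmem
        rcases Finset.mem_insert.mp hmem with h | h
        · have := hlt a' ha't
          rw [h] at ha'x
          linarith
        · exact hxt h

/-- Iterated Rolle: if `F ∈ C^N`, `k + m ≤ N`, and `F^{(k)}` vanishes at `m + 1` points of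
`(a, b)`, then `F^{(k+m)}` vanishes somewhere in `(a, b)`. [folklore] -/
private theorem rolle_chain {F : ℝ → ℝ} {N : ℕ} (hF : ContDiff ℝ N F) {a b : ℝ} :
    ∀ (m k : ℕ) (S : Finset ℝ), k + m ≤ N → S.card = m + 1 →
      (∀ x ∈ S, x ∈ Ioo a b) → (∀ x ∈ S, iteratedDeriv k F x = 0) →
        ∃ ξ ∈ Ioo a b, iteratedDeriv (k + m) F ξ = 0 := by
  intro m
  induction m with
  | zero =>
    intro k S _ hcard hS hzero
    obtain ⟨x, hx⟩ := Finset.card_pos.mp (by omega : 0 < S.card)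
    exact ⟨x, hS x hx, by simpa using hzero x hx⟩
  | succ m ih =>
    intro k S hkm hcard hS hzero
    have hcont : Continuous (iteratedDeriv k F) :=
      hF.continuous_iteratedDeriv k (by exact_mod_cast (by omega : k ≤ N))
    obtain ⟨S', hS'card, hS'zero, hS'loc⟩ :=
      rolle_finset hcont S (Finset.card_pos.mp (by omega)) hzero
    obtain ⟨ξ, hξ, h⟩ := ih (k + 1) S' (by omega) (by omega)
      (fun x hx => by
        obtain ⟨-, ⟨a', ha', hax⟩, ⟨b', hb', hxb⟩⟩ := hS'loc x hx
        exact ⟨(hS a' ha').1.trans hax, hxb.trans (hS b' hb').2⟩)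
      (fun x hx => by rw [iteratedDeriv_succ]; exact hS'zero x hx)
    exact ⟨ξ, hξ, by rw [show k + (m + 1) = k + 1 + m by ring]; exact h⟩

/-! ### Polynomials as smooth functions -/

/-- Polynomial functions are `C^k`. [folklore] -/
private theorem contDiff_eval_poly (p : ℝ[X]) (k : ℕ) : ContDiff ℝ k fun x => p.eval x := by
  induction p using Polynomial.induction_on' with
  | add p q hp hq =>
    simp only [eval_add]
    exact hp.add hq
  | monomial m a =>
    simp only [eval_monomial]
    exact contDiff_const.mul (contDiff_id.pow m)

/-- The `k`-th derivative of `x ↦ p(x)` is `x ↦ p^{(k)}(x)`. [folklore] -/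
private theorem iteratedDeriv_eval_poly (p : ℝ[X]) (k : ℕ) :
    iteratedDeriv k (fun x => p.eval x) = fun x => (derivative^[k] p).eval x := by
  induction k generalizing p with
  | zero => simp
  | succ k ih =>
    rw [iteratedDeriv_succ', Function.iterate_succ_apply]
    have : deriv (fun x => p.eval x) = fun x => p.derivative.eval x :=
      funext fun x => Polynomial.deriv p
    rw [this, ih]

/-- `dⁿ p = n! · (coefficient of xⁿ)` for `deg p ≤ n`. [folklore] -/
private theorem iterate_derivative_eq_C {p : ℝ[X]} {n : ℕ} (hp : p.natDegree ≤ n) :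
    derivative^[n] p = C ((n ! : ℝ) * p.coeff n) := by
  ext m
  rw [coeff_iterate_derivative, nsmul_eq_mul, coeff_C]
  rcases Nat.eq_zero_or_pos m with rfl | hm
  · simp [Nat.descFactorial_self]
  · rw [if_neg hm.ne', coeff_eq_zero_of_natDegree_lt (by omega), mul_zero]

/-! ### The node polynomial -/

/-- The node polynomial `ω_s(x) = ∏_{xᵢ ∈ s} (x - xᵢ)`.
[cite: StoerBulirsch2002, Thm. 2.1.4.1] -/
noncomputable def nodePoly (s : Finset ℝ) : ℝ[X] := ∏ x ∈ s, (X - C x)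

/-- `ω_s(t) = ∏ (t - xᵢ)`. [cite: StoerBulirsch2002, Thm. 2.1.4.1] -/
theorem eval_nodePoly (s : Finset ℝ) (t : ℝ) : (nodePoly s).eval t = ∏ x ∈ s, (t - x) := by
  simp [nodePoly, eval_prod]

/-- `ω_s` is monic. [cite: StoerBulirsch2002, Thm. 2.1.4.1] -/
theorem monic_nodePoly (s : Finset ℝ) : (nodePoly s).Monic :=
  monic_prod_of_monic _ _ fun x _ => monic_X_sub_C x

/-- `deg ω_s = #s`. [cite: StoerBulirsch2002, Thm. 2.1.4.1] -/
theorem natDegree_nodePoly (s : Finset ℝ) : (nodePoly s).natDegree = s.card := by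
  rw [nodePoly, natDegree_prod_of_monic _ _ fun x _ => monic_X_sub_C x]
  simp

/-- `d^{#s} ω_s = (#s)!` (the step `ω^{(n+1)} ≡ (n+1)!` of the proof of the remainder theorem).
[cite: StoerBulirsch2002, Thm. 2.1.4.1] -/
theorem iterate_derivative_nodePoly (s : Finset ℝ) :
    derivative^[s.card] (nodePoly s) = C ((s.card)! : ℝ) := by
  rw [iterate_derivative_eq_C (natDegree_nodePoly s).le]
  have : (nodePoly s).coeff s.card = 1 := by
    rw [← natDegree_nodePoly s]
    exact (monic_nodePoly s).coeff_natDegree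
  rw [this, mul_one]

/-! ### The remainder term -/

/-- **Remainder term of polynomial interpolation.** Let `s` be a set of `N ≥ 1` nodes in `[a, b]`
(`a < b`), `f ∈ C^N`, and `p` a polynomial of degree `< N` with `p = f` on `s`.  Then for every
`t ∈ [a, b]` there is `ξ ∈ (a, b)` with `f(t) - p(t) = f^{(N)}(ξ)/N! · ∏_{xᵢ ∈ s} (t - xᵢ)`.
[cite: StoerBulirsch2002, Thm. 2.1.4.1] [cite: HammerlinHoffman1991, Ch. 5 §1.3] -/
theorem exists_interpolation_remainder {s : Finset ℝ} {N : ℕ} (hN : s.card = N) (hN0 : 0 < N)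
    {f : ℝ → ℝ} (hf : ContDiff ℝ N f) {p : ℝ[X]} (hp : p.degree < N)
    (hfp : ∀ x ∈ s, p.eval x = f x) {a b : ℝ} (hab : a < b) (hs : ∀ x ∈ s, x ∈ Icc a b)
    {t : ℝ} (ht : t ∈ Icc a b) :
    ∃ ξ ∈ Ioo a b, f t - p.eval t = iteratedDeriv N f ξ / N ! * ∏ x ∈ s, (t - x) := by
  classical
  by_cases hts : t ∈ s
  · refine ⟨(a + b) / 2, ⟨by linarith, by linarith⟩, ?_⟩
    rw [hfp t hts, Finset.prod_eq_zero hts (sub_self t)]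
    ring
  have hωt : ∏ x ∈ s, (t - x) ≠ 0 :=
    Finset.prod_ne_zero_iff.mpr fun x hx => sub_ne_zero.mpr fun h => hts (h ▸ hx)
  -- auxiliary function `F = f - p - K ω`, with `F t = 0`
  set K := (f t - p.eval t) / ∏ x ∈ s, (t - x) with hK
  set Q : ℝ[X] := p + C K * nodePoly s with hQ
  set F : ℝ → ℝ := fun x => f x - Q.eval x with hF
  have hFcd : ContDiff ℝ N F := hf.sub (contDiff_eval_poly Q N)
  have hFs : ∀ x ∈ s, F x = 0 := by
    intro x hx
    have hωx : (nodePoly s).eval x = 0 := by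
      rw [eval_nodePoly]; exact Finset.prod_eq_zero hx (sub_self x)
    simp only [hF, hQ, eval_add, eval_mul, eval_C, hωx, hfp x hx]
    ring
  have hFt : F t = 0 := by
    simp only [hF, hQ, eval_add, eval_mul, eval_C, eval_nodePoly, hK]
    field_simp
    ring
  -- `N + 1` zeros of `F` in `[a, b]`, hence `N` zeros of `F'` in `(a, b)`
  have hcard : (insert t s).card = N + 1 := by
    rw [Finset.card_insert_of_notMem hts, hN]
  have hzero : ∀ x ∈ insert t s, F x = 0 := by
    intro x hx
    rcases Finset.mem_insert.mp hx with rfl | hx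
    · exact hFt
    · exact hFs x hx
  have hIcc : ∀ x ∈ insert t s, x ∈ Icc a b := by
    intro x hx
    rcases Finset.mem_insert.mp hx with rfl | hx
    · exact ht
    · exact hs x hx
  obtain ⟨S', hS'card, hS'zero, hS'loc⟩ :=
    rolle_finset hFcd.continuous (insert t s) (Finset.insert_nonempty t s) hzero
  rw [hcard] at hS'card
  have hS'Ioo : ∀ x ∈ S', x ∈ Ioo a b := by
    intro x hx
    obtain ⟨-, ⟨a', ha', hax⟩, ⟨b', hb', hxb⟩⟩ := hS'loc x hx
    exact ⟨(hIcc a' ha').1.trans_lt hax, hxb.trans_le (hIcc b' hb').2⟩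
  have hS'zero' : ∀ x ∈ S', iteratedDeriv 1 F x = 0 := by
    intro x hx
    rw [iteratedDeriv_one]
    exact hS'zero x hx
  -- the remaining `N - 1` Rolle steps
  obtain ⟨ξ, hξ, hξ0⟩ :=
    rolle_chain hFcd (N - 1) 1 S' (by omega) (by omega) hS'Ioo hS'zero'
  rw [show 1 + (N - 1) = N by omega] at hξ0
  refine ⟨ξ, hξ, ?_⟩
  -- evaluate `F^{(N)}(ξ) = f^{(N)}(ξ) - K N!`
  have hsub : iteratedDeriv N F ξ =
      iteratedDeriv N f ξ - iteratedDeriv N (fun x => Q.eval x) ξ := by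
    simp only [hF]
    exact iteratedDeriv_fun_sub hf.contDiffAt (contDiff_eval_poly Q N).contDiffAt
  have hpN : derivative^[N] p = 0 := iterate_derivative_eq_zero_of_degree_lt hp
  have hQN : iteratedDeriv N (fun x => Q.eval x) ξ = K * N ! := by
    rw [iteratedDeriv_eval_poly]
    show (derivative^[N] Q).eval ξ = _
    have hadd : derivative^[N] (p + C K * nodePoly s) =
        derivative^[N] p + derivative^[N] (C K * nodePoly s) :=
      iterate_map_add derivative N p _
    rw [hQ, hadd, hpN, iterate_derivative_C_mul, ← hN, iterate_derivative_nodePoly, zero_add,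
      eval_mul, eval_C, eval_C]
  have hKeq : K = iteratedDeriv N f ξ / N ! := by
    have hfact : (N ! : ℝ) ≠ 0 := by exact_mod_cast Nat.factorial_ne_zero N
    rw [eq_div_iff hfact]
    have := hξ0
    rw [hsub, hQN] at this
    linarith
  rw [← hKeq, hK, div_mul_cancel₀ _ hωt]

/-- **Remainder term bound.** Under the hypotheses of `exists_interpolation_remainder`, if
`|f^{(N)}| ≤ M` on `[a, b]` then `|f(t) - p(t)| ≤ M / N! · |∏ (t - xᵢ)|` for `t ∈ [a, b]`.
[cite: HammerlinHoffman1991, Ch. 5 §1.4] -/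
theorem abs_interpolation_error_le {s : Finset ℝ} {N : ℕ} (hN : s.card = N) (hN0 : 0 < N)
    {f : ℝ → ℝ} (hf : ContDiff ℝ N f) {p : ℝ[X]} (hp : p.degree < N)
    (hfp : ∀ x ∈ s, p.eval x = f x) {a b : ℝ} (hab : a < b) (hs : ∀ x ∈ s, x ∈ Icc a b)
    {M : ℝ} (hM : ∀ x ∈ Icc a b, |iteratedDeriv N f x| ≤ M) {t : ℝ} (ht : t ∈ Icc a b) :
    |f t - p.eval t| ≤ M / N ! * |∏ x ∈ s, (t - x)| := by
  obtain ⟨ξ, hξ, h⟩ := exists_interpolation_remainder hN hN0 hf hp hfp hab hs ht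
  rw [h, abs_mul, abs_div, Nat.abs_cast]
  exact mul_le_mul_of_nonneg_right
    (div_le_div_of_nonneg_right (hM ξ (Ioo_subset_Icc_self hξ)) (Nat.cast_nonneg _))
    (abs_nonneg _)

/-! ### Interpolation at the Chebyshev nodes -/

/-- The Chebyshev nodes of order `n`: the `n` zeros `cos((2k+1)π/(2n))`, `k = 0, …, n-1`, of the
Chebyshev polynomial `T_n`. [cite: HammerlinHoffman1991, Ch. 4 §4.7] -/
noncomputable def chebyshevNodes (n : ℕ) : Finset ℝ :=
  (Finset.range n).image fun k : ℕ => Real.cos ((2 * k + 1) * π / (2 * n))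

/-- There are exactly `n` Chebyshev nodes of order `n` (the cosines are distinct).
[cite: HammerlinHoffman1991, Ch. 4 §4.7] -/
theorem card_chebyshevNodes (n : ℕ) : (chebyshevNodes n).card = n := by
  rw [chebyshevNodes, Finset.card_image_of_injOn
    ((Finset.range n).nodup_map_iff_injOn.mp (Polynomial.Chebyshev.roots_T_real_nodup n)),
    Finset.card_range]

/-- The Chebyshev nodes lie in `[-1, 1]` (indeed in `(-1, 1)`).
[cite: HammerlinHoffman1991, Ch. 4 §4.7] -/
theorem mem_Icc_of_mem_chebyshevNodes {n : ℕ} {x : ℝ} (hx : x ∈ chebyshevNodes n) :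
    x ∈ Icc (-1 : ℝ) 1 := by
  obtain ⟨k, -, rfl⟩ := Finset.mem_image.mp hx
  exact ⟨Real.neg_one_le_cos _, Real.cos_le_one _⟩

/-- `T_n = 2^{n-1} ∏_k (X - x_k)` over the Chebyshev nodes (for `n = 0` both sides are `1`, with
the convention `2^{0-1} = 2^0`).
[cite: HammerlinHoffman1991, Ch. 4 §4.7] -/
theorem chebyshev_T_eq_mul_nodePoly (n : ℕ) :
    Polynomial.Chebyshev.T ℝ n = C ((2 : ℝ) ^ (n - 1)) * nodePoly (chebyshevNodes n) := by
  have hroots : (Polynomial.Chebyshev.T ℝ n).roots = (chebyshevNodes n).val :=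
    Polynomial.Chebyshev.roots_T_real n
  have hcard : Multiset.card (Polynomial.Chebyshev.T ℝ n).roots =
      (Polynomial.Chebyshev.T ℝ n).natDegree := by
    rw [hroots, Finset.card_val, card_chebyshevNodes, Polynomial.Chebyshev.natDegree_T,
      Int.natAbs_natCast]
  have h := C_leadingCoeff_mul_prod_multiset_X_sub_C hcard
  rw [Polynomial.Chebyshev.leadingCoeff_T, Int.natAbs_natCast, hroots] at h
  rw [← h, nodePoly, Finset.prod_eq_multiset_prod]

/-- `∏_k (t - x_k) = T_n(t) / 2^{n-1}` over the Chebyshev nodes.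
[cite: HammerlinHoffman1991, Ch. 4 §4.7] -/
theorem prod_sub_chebyshevNodes (n : ℕ) (t : ℝ) :
    ∏ x ∈ chebyshevNodes n, (t - x) = (Polynomial.Chebyshev.T ℝ n).eval t / 2 ^ (n - 1) := by
  have h := congrArg (fun q => q.eval t) (chebyshev_T_eq_mul_nodePoly n)
  simp only [eval_mul, eval_C, eval_nodePoly] at h
  rw [h, mul_div_cancel_left₀ _ (pow_ne_zero _ two_ne_zero)]

/-- `|∏_k (t - x_k)| ≤ 2^{1-n}` on `[-1, 1]` for the Chebyshev nodes — the minimal value of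
`max |ω|` over all choices of `n` nodes. [cite: HammerlinHoffman1991, Ch. 4 §4.7]
[cite: HammerlinHoffman1991, Ch. 5 §4.1] -/
theorem abs_prod_sub_chebyshevNodes_le (n : ℕ) {t : ℝ} (ht : t ∈ Icc (-1 : ℝ) 1) :
    |∏ x ∈ chebyshevNodes n, (t - x)| ≤ 1 / 2 ^ (n - 1) := by
  have h2 : (0 : ℝ) < 2 ^ (n - 1) := pow_pos two_pos _
  rw [prod_sub_chebyshevNodes n, abs_div, abs_of_pos h2]
  exact div_le_div_of_nonneg_right
    (Polynomial.Chebyshev.abs_eval_T_real_le_one n (abs_le.mpr ⟨ht.1, ht.2⟩)) h2.le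

/-- **Interpolation at the Chebyshev nodes.** If `f ∈ C^n` (`n ≥ 1`), `p` has degree `< n` and
interpolates `f` at the `n` Chebyshev nodes, and `|f^{(n)}| ≤ M` on `[-1, 1]`, then
`|f(t) - p(t)| ≤ M / (2^{n-1} n!)` for all `t ∈ [-1, 1]`. [cite: HammerlinHoffman1991, Ch. 5 §4.1]
[cite: HammerlinHoffman1991, Ch. 5 §1.4] -/
theorem abs_interpolation_error_chebyshevNodes_le {n : ℕ} (hn : n ≠ 0) {f : ℝ → ℝ}
    (hf : ContDiff ℝ n f) {p : ℝ[X]} (hp : p.degree < n)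
    (hfp : ∀ x ∈ chebyshevNodes n, p.eval x = f x)
    {M : ℝ} (hM : ∀ x ∈ Icc (-1 : ℝ) 1, |iteratedDeriv n f x| ≤ M) {t : ℝ}
    (ht : t ∈ Icc (-1 : ℝ) 1) :
    |f t - p.eval t| ≤ M / (2 ^ (n - 1) * n !) := by
  have hM0 : 0 ≤ M := (abs_nonneg _).trans (hM t ht)
  have h := abs_interpolation_error_le (card_chebyshevNodes n) (Nat.pos_of_ne_zero hn) hf hp hfp
    (by norm_num : (-1 : ℝ) < 1) (fun x hx => mem_Icc_of_mem_chebyshevNodes hx) hM ht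
  refine h.trans ?_
  have h2 : (0 : ℝ) < 2 ^ (n - 1) := pow_pos two_pos _
  have hfact : (0 : ℝ) < n ! := by exact_mod_cast Nat.factorial_pos n
  calc M / ↑n ! * |∏ x ∈ chebyshevNodes n, (t - x)|
      ≤ M / ↑n ! * (1 / 2 ^ (n - 1)) :=
        mul_le_mul_of_nonneg_left (abs_prod_sub_chebyshevNodes_le n ht)
          (div_nonneg hM0 hfact.le)
    _ = M / (2 ^ (n - 1) * n !) := by
        field_simp

end Literature.Analysis.Approximation
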